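import Mathlib
import Summits.AtomisticToContinuum.HydrodynamicLimit.Theorems.ImplosionDichotomyDenseExcursionR2Package

/-!
# Vocabulary of the line `packing-analytic-implosion` (crux `DenseExcursion`, stmt-AtomisticToContinuum-12586) —
# the analytic packing implosion `Γ`, the large-real-`Λ` resolvent, the shadowing chart, and the PROVED extraction
# `tunedPacking_of_chart`

Definitions file (`--supports stmt-AtomisticToContinuum-12586`, line lead a2) landing VERBATIM the §0b–§0e vocabulary of the
planner skeleton `Cruxes/DenseExcursion/Lines/packing_analytic_implosion.lean` (v1, sha256 b8463c6b…, planner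
`cruxplan-…-12586-packing-analytic-imp`, 2026-08-17; idea card `Ideas/packing-analytic-implosion.md`, triage r2-1/r2-2 PASS) of the
crux `Summit.AtomisticToContinuum.HydrodynamicLimit.Theses.ImplosionDichotomy.DenseExcursion`, so that its registered stubs
(`stub_largeRealResolvent`, `stub_analyticPackingImplosion`, and the residual heart) can be stated and landed against the tree, and
so that the lead's merged skeleton (`Lines/sonic_cavity_renewal.lean` v2, which feeds the companion line's `Γ` and this chart to ONE
heart, as both line cards recommend) imports them instead of re-positing:

* `packing_nonresonance`, `gauge_nonresonance_on_pinned_window` (PROVED): no packing order `k·3(r−1)` is a smooth eigenvalue;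
* `isentropePressureFactor`, `stiffening`, `stiffening_zero` — the hard-sphere isentropic stiffening factor `M_F`;
* `AnalyticPackingImplosion r W S M` — THE OBJECT `Γ(G, x)`: a one-parameter family, analytic in the central packing `G`, of exact
  solutions of the hs-isentropic self-similar system emanating from the profile at `G = 0`;
* `frozen_profile_solves` (PROVED sanity check: at `M ≡ 1` the frozen profile solves the two equations);
* `LargeRealResolvent r W S` — no smooth mode and smooth centre-regular solvability of `(Λ − L)u = f` for all large real `Λ`;
* `ReachesAt η σ a₀ u₀ θ₀` — the fixed-`σ` clause of the landed `TunedPacking`;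
* `ShadowingChart` — the typed interface of the residual heart (window, threshold two-jet, the two tunings);
* `tunedPacking_of_chart` (PROVED, registered sub-goal): a shadowing chart gives `TunedPacking` (IVT along the zero curve of the
  first Melnikov functional + the choice `η := min η₀ (c/C)^{1/ν}`).

Sources: Cabré–Fontich–de la Llave 2003 (parameterisation method), Buckmaster–Cao-Labora–Gómez-Serrano 2025, Merle–Raphaël–
Rodnianski–Szeftel 2022, Cao-Labora–Gómez-Serrano–Shi–Staffilani arXiv:2310.05325, Boyd–Ramsey–Baty arXiv:1707.03792,
Lebowitz–Penrose 1964 / Ruelle 1969 §3.4 (via the proved `HsEosLowDensity`). NOT here: any proof of a stub.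
-/

noncomputable section

open Filter Set MeasureTheory
open scoped Topology ContDiff

namespace Summit.AtomisticToContinuum.HydrodynamicLimit.Theorems.PackingAnalyticImplosion

open Literature.MathematicalPhysics.KineticTheory
open Summit.AtomisticToContinuum.HydrodynamicLimit.Theses.ImplosionDichotomy
open Summit.AtomisticToContinuum.HydrodynamicLimit.Theorems.R2OneModeTwoConditions

/-! ## Packing non-resonance (kernel-checked): order-by-order solvability of `Γ`'s hierarchy

The `k`-th coefficient of `Γ` solves `(kμ − L) X_k = Src_k` with `μ = 3(r−1)`. By the package, the smooth radial point
spectrum in `Re Λ > 0` is `{Λ₁, r}`; `kμ = Λ₁` is impossible because `2μ < Λ₁ < 3μ` leaves no integer `k`, and `kμ = r`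
(the blow-up-time gauge) is the explicit clause of `stub_profilePackage` (it happens only at `r = 9/8`, inside the BCG
statement window `(11/10, 227/200)` but outside the tree's pinned shooting window `[17307/15625, 89409/80000]`, where
`9(r−1) ≤ 1.0585 < r` and `12(r−1) ≥ 1.2918 > r`). So NO packing order resonates with a smooth mode. (The ideator's
`packing_nonresonance_of_package`, re-typed against the landed vocabulary; triage r2-1/r2-2 re-proved the same.) -/

/-- No smooth radial mode sits at any packing order `kμ`, `k ≥ 1`, for a profile with the `(1,2)` package and the gauge
non-resonance `kμ ≠ r`. [folklore] -/
theorem packing_nonresonance {r : ℝ} {W S : ℝ → ℝ} (h : OneModeTwoConditions r W S)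
    (hg : ∀ k : ℕ, (k : ℝ) * (3 * (r - 1)) ≠ r) :
    ∀ k : ℕ, 1 ≤ k → ∀ ŵ ŝ : ℝ → ℂ,
      ¬ IsSmoothRadialMode r W S (((k : ℝ) * (3 * (r - 1)) : ℝ) : ℂ) ŵ ŝ := by
  intro k hk ŵ ŝ hmode
  obtain ⟨hP, Λ₁, h6, h9, -, -, hexcl⟩ := h
  have hr : 1 < r := hP.1
  have hk1 : (1 : ℝ) ≤ k := by exact_mod_cast hk
  have hμ : 0 < 3 * (r - 1) := by linarith
  have hpos : 0 < (k : ℝ) * (3 * (r - 1)) := mul_pos (by linarith) hμ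
  rcases hexcl _ (by simpa using hpos) ⟨ŵ, ŝ, hmode⟩ with h1 | h2
  · -- `kμ = Λ₁` would force `2 < k < 3`
    have h1' : (k : ℝ) * (3 * (r - 1)) = Λ₁ := by exact_mod_cast h1
    have hlt : (2 : ℝ) < k := by
      by_contra hle
      push Not at hle
      have := mul_le_mul_of_nonneg_right hle hμ.le
      linarith
    have hgt : (k : ℝ) < 3 := by
      by_contra hle
      push Not at hle
      have := mul_le_mul_of_nonneg_right hle hμ.le
      linarith
    have hk3 : (3 : ℝ) ≤ k := by
      have h2k : 2 < k := by exact_mod_cast hlt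
      have h3k : 3 ≤ k := h2k
      exact_mod_cast h3k
    linarith
  · -- `kμ = r` is the excluded gauge resonance
    exact hg k (by exact_mod_cast h2)

/-- The gauge clause of `stub_profilePackage` is VOID on the tree's pinned shooting window
`[17307/15625, 89409/80000] ∋ r₂` (`Literature.Analysis.FluidPDE.CompressibleEulerImplosionShooting.exists_meeting`):
there `9(r−1) < r < 12(r−1)`, so `k·3(r−1) ≠ r` for every `k` (the only resonant speed in the BCG statement window
`(11/10, 227/200)` is `r = 9/8`). Kernel-checked arithmetic, recorded for whoever pins the profile. [folklore] -/
theorem gauge_nonresonance_on_pinned_window {r : ℝ} (hlo : (17307 / 15625 : ℝ) ≤ r) (hhi : r ≤ 89409 / 80000)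
    (k : ℕ) : (k : ℝ) * (3 * (r - 1)) ≠ r := by
  intro h
  have hμ : 0 < 3 * (r - 1) := by linarith
  rcases le_or_gt k 3 with hk | hk
  · have hk' : (k : ℝ) ≤ 3 := by exact_mod_cast hk
    have := mul_le_mul_of_nonneg_right hk' hμ.le
    nlinarith
  · have hk' : (4 : ℝ) ≤ k := by exact_mod_cast hk
    have := mul_le_mul_of_nonneg_right hk' hμ.le
    nlinarith

/-! ## The hard-sphere ISENTROPIC STIFFENING factor and the ANALYTIC PACKING IMPLOSION `Γ`

Along a hard-sphere isentrope `θ = K ρ^{2/3} e^{(2/3)F(φ)}` (`φ = ρσ³`, `F` = excess free energy per particle in units of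
`θ`, `Z = 1 + φF′`), the pressure is `p = K ρ^{5/3} Π(φ)` with `Π = e^{(2/3)F}(1 + φF′)`, so
`∂p/∂ρ|_s = (5/3)Kρ^{2/3}·M(φ)` with `M = Π + (3/5)φΠ′` (`M(0) = 1`, `M′(0) = 16π/9` for `F′(0) = 2π/3`): in the
self-similar isentropic variables `(w, sf)` of `…R2SelfSimilar` (`𝒫 = C‖ζ‖³sf³`, `sf` DEFINED from the density) the
mass equation is EOS-free and the pressure-gradient term of the momentum equation is the ideal one `3 sf (sf′ + sf)`
times `M(φ)`, `φ = 𝒫D³ = G e^{3x} sf³`, `G = C D(τ)³ = G₀ e^{μτ}`, `μ = 3(r − 1)`; the class is exactly invariant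
(entropy transport, landed `EntropyTransportZ` / `Negative/EntropyTransport`). Seeking solutions that depend on `τ`
only through `G` (`∂_τ = μG∂_G`) gives the two equations of `AnalyticPackingImplosion`. -/

/-- The isentrope pressure factor `Π_F(φ) = e^{(2/3)F(φ)} (1 + φ F′(φ))` of an excess free energy `F`. -/
def isentropePressureFactor (F : ℝ → ℝ) (φ : ℝ) : ℝ :=
  Real.exp (2 / 3 * F φ) * (1 + φ * deriv F φ)

/-- The hard-sphere ISENTROPIC STIFFENING factor `M_F(φ) = Π_F(φ) + (3/5) φ Π_F′(φ)`: the ratio of the real-gas to the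
ideal-gas isentropic `∂p/∂ρ` at packing `φ` (`M_F(0) = 1`). -/
def stiffening (F : ℝ → ℝ) (φ : ℝ) : ℝ :=
  isentropePressureFactor F φ + 3 / 5 * φ * deriv (isentropePressureFactor F) φ

/-- `M_F(0) = 1` whenever `F(0) = 0` (the ideal gas at zero packing). -/
theorem stiffening_zero {F : ℝ → ℝ} (hF : F 0 = 0) : stiffening F 0 = 1 := by
  simp [stiffening, isentropePressureFactor, hF]

/-- **THE ANALYTIC PACKING IMPLOSION `Γ`** of the profile `(r, W, S)` for the stiffening law `M` (typed target of the
line; the card's `[A]`, sharpened by triage r2-1 (2): centre regularity uniform in `G`, and stated for the hard-sphere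
`M = stiffening F` by the stubs). There are `g₀ > 0` and `w, s : (G, x) ↦ ℝ`, jointly `C^∞` on `(−g₀, g₀) × ℝ`,
ANALYTIC IN THE PACKING PARAMETER `G` at every `x`, equal to `(W, S)` at `G = 0`, with `s > 0`, CENTRE-REGULAR
uniformly in `G` (the radial fields `y ↦ w(G, log‖y‖) y` and `y ↦ ‖y‖ s(G, log‖y‖)` extend to fields on `ℝ³` jointly
smooth in `(G, y)`, the sound-speed field positive at the origin), solving the hs-isentropic self-similar system with
`∂_τ = μ G ∂_G`, `μ = 3(r−1)`:
`μG ∂_G s = (w−1) ∂_x s + (s/3) ∂_x w + s(2w − r)`,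
`μG ∂_G w = (w−1) ∂_x w + w² − r w + 3 s (∂_x s + s) · M(G e^{3x} s³)`.
Its time realisation `(w, s)(G₀e^{μτ}, x)` is an exact eternal classical solution emanating from `SS` at `τ = −∞`;
`G ↦ G e^{3x} s³` is the packing, `G` the central-packing parameter up to the factor `lim_{x→−∞} e^{3x}S³`. -/
def AnalyticPackingImplosion (r : ℝ) (W S : ℝ → ℝ) (M : ℝ → ℝ) : Prop :=
  ∃ g₀ : ℝ, 0 < g₀ ∧ ∃ w s : ℝ → ℝ → ℝ,
    ContDiffOn ℝ ∞ (fun p : ℝ × ℝ => w p.1 p.2) (Set.Ioo (-g₀) g₀ ×ˢ Set.univ) ∧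
    ContDiffOn ℝ ∞ (fun p : ℝ × ℝ => s p.1 p.2) (Set.Ioo (-g₀) g₀ ×ˢ Set.univ) ∧
    (∀ x, AnalyticOnNhd ℝ (fun G => w G x) (Set.Ioo (-g₀) g₀) ∧
      AnalyticOnNhd ℝ (fun G => s G x) (Set.Ioo (-g₀) g₀)) ∧
    (∀ x, w 0 x = W x ∧ s 0 x = S x) ∧
    (∀ G ∈ Set.Ioo (-g₀) g₀, ∀ x, 0 < s G x) ∧
    (∃ (Fv : ℝ → V3 → V3) (Gc : ℝ → V3 → ℝ),
      ContDiffOn ℝ ∞ (fun p : ℝ × V3 => Fv p.1 p.2) (Set.Ioo (-g₀) g₀ ×ˢ Set.univ) ∧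
      ContDiffOn ℝ ∞ (fun p : ℝ × V3 => Gc p.1 p.2) (Set.Ioo (-g₀) g₀ ×ˢ Set.univ) ∧
      (∀ G ∈ Set.Ioo (-g₀) g₀, 0 < Gc G 0) ∧
      ∀ G ∈ Set.Ioo (-g₀) g₀, ∀ y : V3, y ≠ 0 →
        w G (Real.log ‖y‖) • y = Fv G y ∧ ‖y‖ * s G (Real.log ‖y‖) = Gc G y) ∧
    ∀ G ∈ Set.Ioo (-g₀) g₀, ∀ x,
      3 * (r - 1) * G * deriv (fun G' => s G' x) G =
          (w G x - 1) * deriv (fun x' => s G x') x + s G x / 3 * deriv (fun x' => w G x') x +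
            s G x * (2 * w G x - r) ∧
      3 * (r - 1) * G * deriv (fun G' => w G' x) G =
          (w G x - 1) * deriv (fun x' => w G x') x + w G x ^ 2 - r * w G x +
            3 * s G x * (deriv (fun x' => s G x') x + s G x) * M (G * Real.exp (3 * x) * s G x ^ 3)

/-- SANITY (kernel-checked, not used below): for the IDEAL stiffening `M ≡ 1` the profile itself, frozen in `G`, is a
packing implosion in the sense of the equations — the two equations of `AnalyticPackingImplosion` with `M ≡ 1` at
`G`-independent `(w, s) = (W, S)` are literally the original-form profile equations. So the content of stub A is the `G`-dependence
forced by `M = stiffening F ≢ 1`. [folklore] -/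
theorem frozen_profile_solves {r : ℝ} {W S : ℝ → ℝ}
    (heqs : ∀ x, (W x - 1) * deriv W x + 3 * S x * deriv S x = r * W x - W x ^ 2 - 3 * S x ^ 2 ∧
      (1 - W x) * deriv S x - S x / 3 * deriv W x = S x * (2 * W x - r)) (G x : ℝ) :
    3 * (r - 1) * G * deriv (fun _ : ℝ => S x) G =
        (W x - 1) * deriv (fun x' => S x') x + S x / 3 * deriv (fun x' => W x') x + S x * (2 * W x - r) ∧
      3 * (r - 1) * G * deriv (fun _ : ℝ => W x) G =
        (W x - 1) * deriv (fun x' => W x') x + W x ^ 2 - r * W x +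
          3 * S x * (deriv (fun x' => S x') x + S x) * 1 := by
  obtain ⟨hM, hC⟩ := heqs x
  have e1 : (fun x' => S x') = S := rfl
  have e2 : (fun x' => W x') = W := rfl
  simp only [deriv_const, mul_zero, mul_one, e1, e2]
  constructor
  · linarith
  · linarith

/-! ## The large-real-`Λ` resolvent of the linearised operator (conclusion type of stub L)

NORM-FREE BY DESIGN (planner's self-audit): in the coordinate `x = log y` centre-regular pairs are generally UNBOUNDED
in the sound-speed component (`ŝ ~ d₀e^{−x}` at the centre, like `S` itself and like the gauge mode `S′ + rS`), so a
sup-norm resolvent bound in `x` would be false as a statement about all regular pairs; the natural quantitative form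
(`sup|u₁| + sup eˣ|u₂| ≤ C (sup|f₁| + sup eˣ|f₂|)/Λ`, the `1/Λ` Laplace-transform gain, plus derivative control in
sonic- and centre-centred Taylor norms) depends on the function space in which stub A closes its majorant scheme and is
therefore proved INSIDE stub A. What is filed here is the qualitative half every order of `Γ`'s hierarchy needs. -/

/-- **LARGE-REAL-`Λ` RESOLVENT** (conclusion of `stub_largeRealResolvent`): there is `Λ₀` such that for every REAL
`Λ ≥ Λ₀` (i) the profile has no smooth radial mode at `Λ` (large-real-`Λ` exclusion), and (ii) `(Λ − L)` is ONTO smooth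
centre-regular real pairs: every smooth centre-regular real `f = (f₁, f₂)` (stated through the landed complex vocabulary
by coercion) has a smooth centre-regular real solution `u` of `Λu − Lu = f`, `L = (linW, linS)` — unique by (i). (For such
`Λ` the sonic Frobenius exponent `N(Λ) = (b − Λ)/κ` is negative, so the `C^∞` branch at the repulsive sonic point is
forced, and no boundary condition is needed in the supersonic far field.) -/
def LargeRealResolvent (r : ℝ) (W S : ℝ → ℝ) : Prop :=
  ∃ Λ₀ : ℝ, ∀ Λ : ℝ, Λ₀ ≤ Λ →
    (∀ ŵ ŝ : ℝ → ℂ, ¬ IsSmoothRadialMode r W S (Λ : ℂ) ŵ ŝ) ∧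
    ∀ f₁ f₂ : ℝ → ℝ, IsRegularPair (fun x => (f₁ x : ℂ)) (fun x => (f₂ x : ℂ)) →
      ∃ u₁ u₂ : ℝ → ℝ, IsRegularPair (fun x => (u₁ x : ℂ)) (fun x => (u₂ x : ℂ)) ∧
        ∀ x, (Λ : ℂ) * (u₁ x : ℂ) - linW r W S (fun y => (u₁ y : ℂ)) (fun y => (u₂ y : ℂ)) x = (f₁ x : ℂ) ∧
             (Λ : ℂ) * (u₂ x : ℂ) - linS r W S (fun y => (u₁ y : ℂ)) (fun y => (u₂ y : ℂ)) x = (f₂ x : ℂ)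

/-! ## Reaching packing `η` at ONE diameter, and the SHADOWING CHART (conclusion type of the residual heart H′)

`ReachesAt η σ a₀ u₀ θ₀` is LITERALLY the fixed-`σ` clause of the landed `TunedPacking` (`…R2Package.lean`): the
classical hard-sphere Euler solution launched from THE `EosRelated` local-equilibrium density of the activity `a₀`
(`eosRelated_unique`, `eosRelated_rhoLim`) with `(u₀, θ₀)` reaches packing `η` on its interval of classical existence. -/

/-- Fixed-`σ` clause of `TunedPacking`: the pinned hard-sphere development of `(a₀, u₀, θ₀)` at diameter `σ` reaches
packing `η`. -/
def ReachesAt (η σ : ℝ) (a₀ : T3 → ℝ) (u₀ : T3 → V3) (θ₀ : T3 → ℝ) : Prop :=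
  ∃ n : T3 → ℝ, EosRelated σ a₀ n ∧
    ∃ (T : ℝ) (ρ θ : ℝ → T3 → ℝ) (u : ℝ → T3 → V3), IsHardSphereEulerSolution σ T ρ u θ ∧
      ρ 0 = n ∧ u 0 = u₀ ∧ θ 0 = θ₀ ∧ ∃ t ∈ Set.Ico 0 T, ∃ x, η ≤ ρ t x * σ ^ 3

/-- **SHADOWING CHART** — the typed interface delivered by the residual heart `stub_shadowingChart` (the card's
`[B] + [C] + [D]`, forcing-free around `Γ`). A THREE-PARAMETER family of `σ`-INDEPENDENT continuous positive data
`(a, b, β) ↦ (act, vel, temp)` on `𝕋³` — intended: the exact `SS(r)`-seed core datum, Kidder-sheared by the knob `b`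
(`ProjectiveCovariance`, landed), moved along a stable direction by `β`, and corrected by `a` times a fixed radial bump
pairing non-trivially with the unstable mode — together with
* `window` (UNFORCED CODIMENSION-ONE STABILITY OF `Γ`, shooting form): a threshold `aStar σ b β` such that for EVERY
  level `η ≤ η₀` and every `σ < σ₁`, each member with `|a − aStar σ b β| ≤ c (σ³/η)^ν` reaches packing `η` at diameter
  `σ` (its pinned hard-sphere development is trapped near the stable leaf of `Γ` until the central packing `G` of `Γ`
  has run from `O(σ³)` to `η`; the window is the unstable coordinate's budget `e^{−Λ₁(τ_η − τ₀)} = (κσ³/η)^{Λ₁/μ}`);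
* `jets` (THRESHOLD TWO-JET): `aStar σ b β = a0 b β + σ³ a1 b β + σ⁶ a2 b β + O(σ^{3ν})` with `2 < ν < 3`
  (`ν = Λ₁/μ`: orders `σ⁹` and beyond are inside the window — slaving, landed `SlavingODE`; `a0 b β` places the base
  member on the `σ = 0` stable leaf of `SS(r)`; `a1, a2` are the two Melnikov functionals, pairings of the datum's
  statics jets `h₁, h₂` (`TiedStatics`) and of `Γ`'s jets `X₁, X₂` against the leaf);
* `bZero`, `a1_zero` (FIRST TUNING by the knob): a continuous curve `b = bZero β` in the box along which `a1` vanishes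
  (the cubic `K₁(1 + bT)` of the Kidder knob has a transversal root; `b₀T ≈ −0.42` at `β = 0`, three codes);
* `a1_sign` (documents the knob: opposite strict signs of `a1` on the two `b`-edges of the box — the transversal root);
* `bottom`, `top` (SECOND TUNING, certified numerics): `a2` changes sign strictly along that curve between `βLo` and
  `βHi` (`G₂ = +0.09 → −0.015` across `β ∈ [0, 16 %]` along the sonic density bump, zero near `13.8 %`, c2-0).
Nothing here restates the crux: every field is a statement about ONE diameter at a time or about `σ`-free functions;
the crux (a `σ`-INDEPENDENT datum reaching a FIXED `η` along `σ → 0`) is extracted below by the intermediate value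
theorem and the choice `η := min η₀ (c/C)^{1/ν}`. -/
structure ShadowingChart where
  /-- knob box -/
  bLo : ℝ
  bHi : ℝ
  /-- stable-direction box -/
  βLo : ℝ
  βHi : ℝ
  hβ : βLo ≤ βHi
  /-- member `(a, b, β)`: activity, velocity and temperature data on `𝕋³` (all `σ`-independent) -/
  act : ℝ → ℝ → ℝ → T3 → ℝ
  vel : ℝ → ℝ → ℝ → T3 → V3
  temp : ℝ → ℝ → ℝ → T3 → ℝ
  cont : ∀ a b β, Continuous (act a b β) ∧ Continuous (vel a b β) ∧ Continuous (temp a b β)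
  pos : ∀ a b β x, 0 < act a b β x ∧ 0 < temp a b β x
  /-- window exponent `ν = Λ₁/μ`, top packing level `η₀`, diameter range `σ₁`, window and remainder constants -/
  ν : ℝ
  η₀ : ℝ
  σ₁ : ℝ
  c : ℝ
  C : ℝ
  hν : 2 < ν ∧ ν < 3
  hη₀ : 0 < η₀
  hσ₁ : 0 < σ₁
  hc : 0 < c
  hC : 0 < C
  /-- the trapping threshold in the corrector amplitude at diameter `σ` -/
  aStar : ℝ → ℝ → ℝ → ℝ
  /-- its jets: leaf position, first and second Melnikov functionals -/
  a0 : ℝ → ℝ → ℝ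
  a1 : ℝ → ℝ → ℝ
  a2 : ℝ → ℝ → ℝ
  window : ∀ η : ℝ, 0 < η → η ≤ η₀ → ∀ σ : ℝ, 0 < σ → σ < σ₁ →
    ∀ b ∈ Set.Icc bLo bHi, ∀ β ∈ Set.Icc βLo βHi, ∀ a : ℝ,
      |a - aStar σ b β| ≤ c * (σ ^ 3 / η) ^ ν → ReachesAt η σ (act a b β) (vel a b β) (temp a b β)
  jets : ∀ σ : ℝ, 0 < σ → σ < σ₁ → ∀ b ∈ Set.Icc bLo bHi, ∀ β ∈ Set.Icc βLo βHi,
    |aStar σ b β - (a0 b β + σ ^ 3 * a1 b β + σ ^ 6 * a2 b β)| ≤ C * (σ ^ 3) ^ ν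
  a2_cont : ContinuousOn (fun p : ℝ × ℝ => a2 p.1 p.2) (Set.Icc bLo bHi ×ˢ Set.Icc βLo βHi)
  /-- the zero curve of the first Melnikov functional (knob tuning) -/
  bZero : ℝ → ℝ
  bZero_cont : ContinuousOn bZero (Set.Icc βLo βHi)
  bZero_mem : ∀ β ∈ Set.Icc βLo βHi, bZero β ∈ Set.Icc bLo bHi
  a1_zero : ∀ β ∈ Set.Icc βLo βHi, a1 (bZero β) β = 0
  /-- the first Melnikov functional has opposite strict signs on the two knob edges (transversal root of the Kidder
  cubic; documents the knob tuning — not consumed by the composition, which reads the zero curve `bZero`) -/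
  a1_sign : ∀ β ∈ Set.Icc βLo βHi, a1 bLo β < 0 ∧ 0 < a1 bHi β
  /-- the second Melnikov functional changes sign STRICTLY along the zero curve of the first -/
  bottom : a2 (bZero βLo) βLo < 0
  top : 0 < a2 (bZero βHi) βHi

/-! ## The extraction (proved): a shadowing chart gives tuned packing -/

/-- **THE TWICE-TUNED DATUM REACHES A FIXED PACKING ALONG `σ → 0`.** From a shadowing chart: the second tuning by the
intermediate value theorem along the zero curve of the first (`a1 = a2 = 0` at `(bZero β̄, β̄)`), the level
`η := min η₀ (c/C)^{1/ν}` making the two-jet remainder `C σ^{3ν}` fit inside the window `c (σ³/η)^ν` at EVERY small `σ`,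
and the window itself; the member `(a0 b̄ β̄, b̄, β̄)` is the `σ`-independent witness of `TunedPacking`. -/
theorem tunedPacking_of_chart : ∀ Ch : ShadowingChart, TunedPacking := by
  intro Ch
  -- second tuning: IVT for `β ↦ a2 (bZero β) β` on `[βLo, βHi]`
  have hgc : ContinuousOn (fun β => Ch.a2 (Ch.bZero β) β) (Set.Icc Ch.βLo Ch.βHi) := by
    have hmaps : Set.MapsTo (fun β => (Ch.bZero β, β)) (Set.Icc Ch.βLo Ch.βHi)
        (Set.Icc Ch.bLo Ch.bHi ×ˢ Set.Icc Ch.βLo Ch.βHi) := fun β hβ => ⟨Ch.bZero_mem β hβ, hβ⟩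
    have hpair : ContinuousOn (fun β => (Ch.bZero β, β)) (Set.Icc Ch.βLo Ch.βHi) :=
      Ch.bZero_cont.prodMk continuousOn_id
    exact Ch.a2_cont.comp hpair hmaps
  obtain ⟨β₀, hβ₀, hzero⟩ : ∃ β₀ ∈ Set.Icc Ch.βLo Ch.βHi, Ch.a2 (Ch.bZero β₀) β₀ = 0 :=
    intermediate_value_Icc Ch.hβ hgc ⟨Ch.bottom.le, Ch.top.le⟩
  have hb₀ : Ch.bZero β₀ ∈ Set.Icc Ch.bLo Ch.bHi := Ch.bZero_mem β₀ hβ₀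
  have h1 : Ch.a1 (Ch.bZero β₀) β₀ = 0 := Ch.a1_zero β₀ hβ₀
  have h2 : Ch.a2 (Ch.bZero β₀) β₀ = 0 := hzero
  -- the packing level
  have hν : 0 < Ch.ν := by linarith [Ch.hν.1]
  have hcC : 0 < Ch.c / Ch.C := div_pos Ch.hc Ch.hC
  set η : ℝ := min Ch.η₀ ((Ch.c / Ch.C) ^ (1 / Ch.ν)) with hηdef
  have hηpos : 0 < η := lt_min Ch.hη₀ (Real.rpow_pos_of_pos hcC _)
  have hηle : η ≤ Ch.η₀ := min_le_left _ _
  have hηpow : η ^ Ch.ν ≤ Ch.c / Ch.C := by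
    have hle : η ≤ (Ch.c / Ch.C) ^ (1 / Ch.ν) := min_le_right _ _
    calc η ^ Ch.ν ≤ ((Ch.c / Ch.C) ^ (1 / Ch.ν)) ^ Ch.ν := Real.rpow_le_rpow hηpos.le hle hν.le
      _ = Ch.c / Ch.C := by
          rw [← Real.rpow_mul hcC.le, one_div, inv_mul_cancel₀ hν.ne', Real.rpow_one]
  have hCη : Ch.C * η ^ Ch.ν ≤ Ch.c := by
    have h := mul_le_mul_of_nonneg_left hηpow Ch.hC.le
    have hC0 : Ch.C ≠ 0 := Ch.hC.ne'
    have e : Ch.C * (Ch.c / Ch.C) = Ch.c := by field_simp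
    linarith
  -- the witness
  refine ⟨η, hηpos, Ch.act (Ch.a0 (Ch.bZero β₀) β₀) (Ch.bZero β₀) β₀,
    Ch.temp (Ch.a0 (Ch.bZero β₀) β₀) (Ch.bZero β₀) β₀, Ch.vel (Ch.a0 (Ch.bZero β₀) β₀) (Ch.bZero β₀) β₀,
    (Ch.cont _ _ _).1, (Ch.cont _ _ _).2.2, (Ch.cont _ _ _).2.1, fun x => (Ch.pos _ _ _ x).1,
    fun x => (Ch.pos _ _ _ x).2, fun σ₀ hσ₀ => ?_⟩
  -- a diameter below both thresholds
  have hmin : 0 < min σ₀ Ch.σ₁ := lt_min hσ₀ Ch.hσ₁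
  have hσpos : 0 < min σ₀ Ch.σ₁ / 2 := half_pos hmin
  refine ⟨min σ₀ Ch.σ₁ / 2, hσpos, (half_lt_self hmin).trans_le (min_le_left _ _), ?_⟩
  have hσlt₁ : min σ₀ Ch.σ₁ / 2 < Ch.σ₁ := (half_lt_self hmin).trans_le (min_le_right _ _)
  -- the window applies because the two-jet remainder fits inside it
  refine Ch.window η hηpos hηle _ hσpos hσlt₁ _ hb₀ β₀ hβ₀ _ ?_
  have hj := Ch.jets _ hσpos hσlt₁ _ hb₀ β₀ hβ₀
  simp only [h1, h2, mul_zero, add_zero] at hj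
  rw [abs_sub_comm] at hj
  have hσ3 : 0 < (min σ₀ Ch.σ₁ / 2) ^ 3 := pow_pos hσpos 3
  have hx : 0 < ((min σ₀ Ch.σ₁ / 2) ^ 3) ^ Ch.ν := Real.rpow_pos_of_pos hσ3 _
  have hηx : 0 < η ^ Ch.ν := Real.rpow_pos_of_pos hηpos _
  calc |Ch.a0 (Ch.bZero β₀) β₀ - Ch.aStar (min σ₀ Ch.σ₁ / 2) (Ch.bZero β₀) β₀|
      ≤ Ch.C * ((min σ₀ Ch.σ₁ / 2) ^ 3) ^ Ch.ν := hj
    _ ≤ Ch.c * ((min σ₀ Ch.σ₁ / 2) ^ 3 / η) ^ Ch.ν := by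
        rw [Real.div_rpow hσ3.le hηpos.le, mul_div_assoc', le_div_iff₀ hηx]
        calc Ch.C * ((min σ₀ Ch.σ₁ / 2) ^ 3) ^ Ch.ν * η ^ Ch.ν
            = (Ch.C * η ^ Ch.ν) * ((min σ₀ Ch.σ₁ / 2) ^ 3) ^ Ch.ν := by ring
          _ ≤ Ch.c * ((min σ₀ Ch.σ₁ / 2) ^ 3) ^ Ch.ν := mul_le_mul_of_nonneg_right hCη hx.le

end Summit.AtomisticToContinuum.HydrodynamicLimit.Theorems.PackingAnalyticImplosion

end
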